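import Summits.KontsevichZagierPeriods.KontsevichZagierPeriods.Theses.IsogenyCertificates
import Summits.KontsevichZagierPeriods.KontsevichZagierPeriods.Theorems.EffectiveXMapChains.Negative.Mechanism

/-!
# Stub `stub_dup` — the duplication datum lands in the unbounded component
(crux `EffectiveXMapChains`, stmt-KontsevichZagierPeriods-10664, line `full-component-sheets`)

For a nonsingular `P = X³ + AX + B` (`4A³ + 27B² ≠ 0`) the x-map of `[2]` on `y² = P(x)` is
`R₂ = f₂/g₂` with `f₂ = X⁴ − 2AX² − 8BX + A²`, `g₂ = 4P` (Silverman, AEC III.2.3(d)). The line's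
skeleton consumes five facts about it:

* (a) `IsCoprime f₂ g₂` (explicit Bezout identity through the discriminant),
  (b) `W₂ = f₂'g₂ − f₂g₂' ≠ 0` (its `X⁶`-coefficient is `4`),
  (c) the datum identity `2²·g₂·(f₂³ + A f₂ g₂² + B g₂³) = P·W₂²` (a `ring` identity);
* (d) `max (natDegree f₂) (natDegree g₂) ≤ 4` (`compute_degree`);
* (e) on the sheet set `{P > 0, g₂ ≠ 0, W₂ ≠ 0}` every `s ≥ R₂(x)` has `P(s) > 0`: `P(R₂ x) > 0` by
  the mechanism lemma `P'_comp_R_pos` (Negative/Mechanism); every real root `e` of `P` satisfies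
  `e ≤ R₂(x)` by the 2-descent square identity
  `f₂ − e·g₂ = (x² − 2ex − 2e² − A)² − 4(2x + e)(e³ + Ae + B)`; so if `P(s) ≤ 0` for some
  `s ≥ R₂ x`, the intermediate value theorem produces a root `e ∈ [R₂ x, s]` of `P`, forced to
  equal `R₂ x` — contradiction.

The algebraic lemmas of `namespace Dup` for (a)–(c) and the descent inequality are adapted from the
sibling crux's file `Theorems/IsogenyCertificatesXMapPeriodTransferStubDupDatum.lean` (inlined
here because that module is not importable from this one). No definitions are introduced.
-/

noncomputable section

open Polynomial Set
open Summit.KontsevichZagierPeriods.IsogenyCertificates.EffectiveXMapChainsNegative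

namespace Summit.KontsevichZagierPeriods.IsogenyCertificates.EffectiveXMapChainsLine

namespace Dup

-- adapted from Theorems/IsogenyCertificatesXMapPeriodTransferStubDupDatum.lean (`stub_dupDatum_wronskian`)
/-- Wronskian of the duplication datum:
`W₂ = 4X⁶ + 20AX⁴ + 80BX³ − 20A²X² − 16ABX − (4A³ + 32B²)` (= `ψ₄/y`). [folklore] -/
private theorem wronskian_eq (A B : ℚ) :
    derivative (X ^ 4 - C (2 * A) * X ^ 2 - C (8 * B) * X + C (A ^ 2)) *
        (C 4 * (X ^ 3 + C A * X + C B)) -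
      (X ^ 4 - C (2 * A) * X ^ 2 - C (8 * B) * X + C (A ^ 2)) *
        derivative (C 4 * (X ^ 3 + C A * X + C B)) =
    C 4 * X ^ 6 + C (20 * A) * X ^ 4 + C (80 * B) * X ^ 3 - C (20 * A ^ 2) * X ^ 2 -
      C (16 * A * B) * X - C (4 * A ^ 3 + 32 * B ^ 2) := by
  simp only [derivative_sub, derivative_add, derivative_mul, derivative_X_pow, derivative_C,
    derivative_X, Nat.cast_ofNat, Nat.add_one_sub_one, pow_one, zero_mul, zero_add,
    add_zero, mul_one]
  refine Polynomial.funext fun x => ?_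
  simp only [eval_sub, eval_add, eval_mul, eval_pow, eval_C, eval_X]
  ring

-- adapted from Theorems/IsogenyCertificatesXMapPeriodTransferStubDupDatum.lean (`stub_dupDatum_wronskian_ne_zero`)
/-- The Wronskian `W₂` of the duplication datum is non-zero (its `X⁶`-coefficient is `4`).
[folklore] -/
theorem wronskian_ne_zero (A B : ℚ) :
    derivative (X ^ 4 - C (2 * A) * X ^ 2 - C (8 * B) * X + C (A ^ 2)) *
        (C 4 * (X ^ 3 + C A * X + C B)) -
      (X ^ 4 - C (2 * A) * X ^ 2 - C (8 * B) * X + C (A ^ 2)) *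
        derivative (C 4 * (X ^ 3 + C A * X + C B)) ≠ 0 := by
  rw [wronskian_eq]
  intro h
  have := congrArg (fun p : ℚ[X] => p.coeff 6) h
  simp only [coeff_add, coeff_sub, coeff_C_mul, coeff_X_pow, coeff_C, coeff_X, coeff_zero] at this
  norm_num at this

-- adapted from Theorems/IsogenyCertificatesXMapPeriodTransferStubDupDatum.lean (`stub_dupDatum_isDatum`)
/-- The certificate identity of the duplication datum with multiplier `c = 2`:
`2²·g₂·(f₂³ + A f₂ g₂² + B g₂³) = P·W₂²` (checked by `ring` after evaluation).
[cite: SilvermanAEC2009, III.2.3(d)] -/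
theorem isDatum (A B : ℚ) :
    C ((2 : ℚ) ^ 2) * (C 4 * (X ^ 3 + C A * X + C B)) *
      ((X ^ 4 - C (2 * A) * X ^ 2 - C (8 * B) * X + C (A ^ 2)) ^ 3 +
        C A * (X ^ 4 - C (2 * A) * X ^ 2 - C (8 * B) * X + C (A ^ 2)) *
          (C 4 * (X ^ 3 + C A * X + C B)) ^ 2 +
        C B * (C 4 * (X ^ 3 + C A * X + C B)) ^ 3) =
    (X ^ 3 + C A * X + C B) *
      (derivative (X ^ 4 - C (2 * A) * X ^ 2 - C (8 * B) * X + C (A ^ 2)) *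
          (C 4 * (X ^ 3 + C A * X + C B)) -
        (X ^ 4 - C (2 * A) * X ^ 2 - C (8 * B) * X + C (A ^ 2)) *
          derivative (C 4 * (X ^ 3 + C A * X + C B))) ^ 2 := by
  rw [wronskian_eq]
  refine Polynomial.funext fun x => ?_
  simp only [eval_sub, eval_add, eval_mul, eval_pow, eval_C, eval_X]
  ring

-- adapted from Theorems/IsogenyCertificatesXMapPeriodTransferStubDupDatum.lean (`stub_dupDatum_bezout`)
/-- Abstract Bezout identity behind the coprimality of the duplication datum: with
`P = x³ + ax + b`, `P' = 3x² + a`, `α = −6ax² + 9bx − 4a²`, `β = 18ax − 27b` one has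
`αP' + βP = −(4a³ + 27b²)` and `α²(P'² − 8xP) + (8xα² + 2αβP' + β²P)P = (αP' + βP)²`; so if
`di·(4a³ + 27b²) = 1` and `c4i·c4 = 1` then `di²α²·(P'² − 8xP) + di²(…)c4i·(c4·P) = 1`.
[folklore] -/
private theorem bezout {R : Type*} [CommRing R] (a b x di c4 c4i : R)
    (hdi : di * (4 * a ^ 3 + 27 * b ^ 2) = 1) (h4 : c4i * c4 = 1) :
    di ^ 2 * (-(6 * a * x ^ 2) + 9 * b * x - 4 * a ^ 2) ^ 2 *
        ((3 * x ^ 2 + a) ^ 2 - 8 * x * (x ^ 3 + a * x + b)) +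
      di ^ 2 * (8 * x * (-(6 * a * x ^ 2) + 9 * b * x - 4 * a ^ 2) ^ 2 +
          2 * (-(6 * a * x ^ 2) + 9 * b * x - 4 * a ^ 2) * (18 * a * x - 27 * b) *
            (3 * x ^ 2 + a) +
          (18 * a * x - 27 * b) ^ 2 * (x ^ 3 + a * x + b)) * c4i *
        (c4 * (x ^ 3 + a * x + b)) = 1 := by
  have key : (-(6 * a * x ^ 2) + 9 * b * x - 4 * a ^ 2) * (3 * x ^ 2 + a) +
      (18 * a * x - 27 * b) * (x ^ 3 + a * x + b) = -(4 * a ^ 3 + 27 * b ^ 2) := by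
    ring
  linear_combination
    (di ^ 2 * (8 * x * (-(6 * a * x ^ 2) + 9 * b * x - 4 * a ^ 2) ^ 2 +
          2 * (-(6 * a * x ^ 2) + 9 * b * x - 4 * a ^ 2) * (18 * a * x - 27 * b) *
            (3 * x ^ 2 + a) +
          (18 * a * x - 27 * b) ^ 2 * (x ^ 3 + a * x + b)) * (x ^ 3 + a * x + b)) * h4 +
      (di ^ 2 * ((-(6 * a * x ^ 2) + 9 * b * x - 4 * a ^ 2) * (3 * x ^ 2 + a) +
          (18 * a * x - 27 * b) * (x ^ 3 + a * x + b) - (4 * a ^ 3 + 27 * b ^ 2))) * key +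
      (di * (4 * a ^ 3 + 27 * b ^ 2) + 1) * hdi

-- adapted from Theorems/IsogenyCertificatesXMapPeriodTransferStubDupDatum.lean (`stub_dupDatum_isCoprime`)
/-- Coprimality of the duplication datum of a nonsingular curve: if `4A³ + 27B² ≠ 0` then
`f₂ = X⁴ − 2AX² − 8BX + A²` and `g₂ = 4(X³ + AX + B)` are coprime in `ℚ[X]`. [folklore] -/
theorem isCoprime (A B : ℚ) (hΔ : 4 * A ^ 3 + 27 * B ^ 2 ≠ 0) :
    IsCoprime (X ^ 4 - C (2 * A) * X ^ 2 - C (8 * B) * X + C (A ^ 2))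
      (C 4 * (X ^ 3 + C A * X + C B)) := by
  have hf : (X ^ 4 - C (2 * A) * X ^ 2 - C (8 * B) * X + C (A ^ 2) : ℚ[X]) =
      (3 * X ^ 2 + C A) ^ 2 - 8 * X * (X ^ 3 + C A * X + C B) := by
    simp only [map_mul, map_pow, map_ofNat]
    ring
  have hC : (4 * C A ^ 3 + 27 * C B ^ 2 : ℚ[X]) = C (4 * A ^ 3 + 27 * B ^ 2) := by
    simp only [map_add, map_mul, map_pow, map_ofNat]
  have hdi : C (4 * A ^ 3 + 27 * B ^ 2)⁻¹ * (4 * C A ^ 3 + 27 * C B ^ 2 : ℚ[X]) = 1 := by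
    rw [hC, ← C_mul, inv_mul_cancel₀ hΔ, C_1]
  have h4 : C (4 : ℚ)⁻¹ * C (4 : ℚ) = 1 := by
    rw [← C_mul, inv_mul_cancel₀ (by norm_num), C_1]
  rw [hf]
  exact ⟨_, _, bezout (C A) (C B) X (C (4 * A ^ 3 + 27 * B ^ 2)⁻¹) (C 4) (C 4⁻¹) hdi h4⟩

-- adapted from Theorems/IsogenyCertificatesXMapPeriodTransferStubDupDatum.lean (`stub_dupDatum_ge_root`)
/-- **2-descent root domination.** On `{P > 0}` the duplication x-map dominates every real root
`e` of `P`, by the square identity `f₂ − e·g₂ = (x² − 2ex − 2e² − A)² − 4(2x + e)(e³ + Ae + B)`.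
[folklore] -/
theorem root_le_xMap (A B e x : ℝ) (he : e ^ 3 + A * e + B = 0)
    (hx : 0 < x ^ 3 + A * x + B) :
    e ≤ (x ^ 4 - 2 * A * x ^ 2 - 8 * B * x + A ^ 2) / (4 * (x ^ 3 + A * x + B)) := by
  rw [le_div_iff₀ (by positivity)]
  have key : (x ^ 4 - 2 * A * x ^ 2 - 8 * B * x + A ^ 2) - e * (4 * (x ^ 3 + A * x + B)) =
      (x ^ 2 - 2 * e * x - 2 * e ^ 2 - A) ^ 2 - 4 * (2 * x + e) * (e ^ 3 + A * e + B) := by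
    ring
  rw [he, mul_zero, sub_zero] at key
  nlinarith [key, sq_nonneg (x ^ 2 - 2 * e * x - 2 * e ^ 2 - A)]

/-- `natDegree (X⁴ − 2AX² − 8BX + A²) ≤ 4`. [folklore] -/
theorem natDegree_f₂_le (A B : ℚ) :
    (X ^ 4 - C (2 * A) * X ^ 2 - C (8 * B) * X + C (A ^ 2) : ℚ[X]).natDegree ≤ 4 := by
  compute_degree

/-- `natDegree (4·(X³ + AX + B)) ≤ 3`. [folklore] -/
theorem natDegree_g₂_le (A B : ℚ) :
    (C 4 * (X ^ 3 + C A * X + C B) : ℚ[X]).natDegree ≤ 3 := by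
  compute_degree

/-- **The unbounded component of `{P > 0}`.** If `P(r) > 0` for the real cubic
`P = X³ + AX + B` and every real root of `P` is `≤ r`, then `P(s) > 0` for every `s ≥ r`
(intermediate value theorem on `[r, s]`). [folklore] -/
theorem cubic_pos_of_roots_le (A B r : ℝ) (hr : 0 < r ^ 3 + A * r + B)
    (hroot : ∀ e : ℝ, e ^ 3 + A * e + B = 0 → e ≤ r) {s : ℝ} (hs : r ≤ s) :
    0 < s ^ 3 + A * s + B := by
  by_contra hneg
  have hcont : ContinuousOn (fun t : ℝ => t ^ 3 + A * t + B) (Icc r s) := by fun_prop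
  obtain ⟨e, ⟨hre, _⟩, he⟩ := intermediate_value_Icc' hs hcont ⟨not_lt.mp hneg, hr.le⟩
  have her : e = r := le_antisymm (hroot e he) hre
  subst her
  exact hr.ne' he

end Dup

/-- **Stub (the duplication datum).** For nonsingular `(A, B)`, `x ∘ [2] = f₂/g₂` with
`f₂ = X⁴ − 2AX² − 8BX + A²`, `g₂ = 4(X³ + AX + B)`: `f₂`, `g₂` are coprime (their resultant is a
power of the discriminant), `W₂ ≠ 0`, the datum identity holds with `c = 2` (`[2]^*(dx/y) = 2dx/y`,
a `ring` identity), the degree is `≤ 4`, and on the sheet set `x([2]Q) ≥` every real root of `P`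
(`f₂ − e·g₂ = (X² − 2eX − A − 2e²)²` modulo `P(e)`), so every value lies in the unbounded component
`{x | ∀ t ≥ x, P(t) > 0}`. [cite: SilvermanAEC2009, III.2.3(d)] -/
theorem stub_dup (A B : ℤ) (hΔ : 4 * A ^ 3 + 27 * B ^ 2 ≠ 0) : IsCoprime (X ^ 4 - C (2 * (A : ℚ)) * X ^ 2 - C (8 * (B : ℚ)) * X + C ((A : ℚ) ^ 2)) (C (4 : ℚ) * (X ^ 3 + C (A : ℚ) * X + C (B : ℚ))) ∧ derivative (X ^ 4 - C (2 * (A : ℚ)) * X ^ 2 - C (8 * (B : ℚ)) * X + C ((A : ℚ) ^ 2)) * (C (4 : ℚ) * (X ^ 3 + C (A : ℚ) * X + C (B : ℚ))) - (X ^ 4 - C (2 * (A : ℚ)) * X ^ 2 - C (8 * (B : ℚ)) * X + C ((A : ℚ) ^ 2)) * derivative (C (4 : ℚ) * (X ^ 3 + C (A : ℚ) * X + C (B : ℚ))) ≠ 0 ∧ C ((2 : ℚ) ^ 2) * (C (4 : ℚ) * (X ^ 3 + C (A : ℚ) * X + C (B : ℚ))) * ((X ^ 4 - C (2 * (A : ℚ))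 * X ^ 2 - C (8 * (B : ℚ)) * X + C ((A : ℚ) ^ 2)) ^ 3 + C (A : ℚ) * (X ^ 4 - C (2 * (A : ℚ)) * X ^ 2 - C (8 * (B : ℚ)) * X + C ((A : ℚ) ^ 2)) * (C (4 : ℚ) * (X ^ 3 + C (A : ℚ) * X + C (B : ℚ))) ^ 2 + C (B : ℚ) * (C (4 : ℚ) * (X ^ 3 + C (A : ℚ) * X + C (B : ℚ))) ^ 3) = (X ^ 3 + C (A : ℚ) * X + C (B : ℚ)) * (derivative (X ^ 4 - C (2 * (A : ℚ)) * X ^ 2 - C (8 * (B : ℚ)) * X + C ((A : ℚ) ^ 2)) * (C (4 : ℚ) * (X ^ 3 + C (A : ℚ) * X + C (B : ℚ))) - (X ^ 4 - C (2 * (A : ℚ)) * X ^ 2 - C (8 * (B : ℚ)) * X + C ((A : ℚ) ^ 2)) * derivative (C (4 : ℚ) * (X ^ 3 + C (A : ℚ) * X + C (B : ℚ)))) ^ 2 ∧ max (X ^ 4 - C (2 * (A : ℚ)) * X ^ 2 - C (8 * (B : ℚ)) * X + C ((A : ℚ) ^ 2)).natDegree (C (4 : ℚ) * (X ^ 3 +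 C (A : ℚ) * X + C (B : ℚ))).natDegree ≤ 4 ∧ ∀ x ∈ {x : ℝ | 0 < x ^ 3 + (A : ℝ) * x + (B : ℝ) ∧ aeval x (C (4 : ℚ) * (X ^ 3 + C (A : ℚ) * X + C (B : ℚ))) ≠ 0 ∧ aeval x (derivative (X ^ 4 - C (2 * (A : ℚ)) * X ^ 2 - C (8 * (B : ℚ)) * X + C ((A : ℚ) ^ 2)) * (C (4 : ℚ) * (X ^ 3 + C (A : ℚ) * X + C (B : ℚ))) - (X ^ 4 - C (2 * (A : ℚ)) * X ^ 2 - C (8 * (B : ℚ)) * X + C ((A : ℚ) ^ 2)) * derivative (C (4 : ℚ) * (X ^ 3 + C (A : ℚ) * X + C (B : ℚ)))) ≠ 0}, ∀ s : ℝ, aeval x (X ^ 4 - C (2 * (A : ℚ)) * X ^ 2 - C (8 * (B : ℚ)) * X + C ((A : ℚ) ^ 2)) / aeval x (C (4 : ℚ) * (X ^ 3 + C (A : ℚ) * X + C (B : ℚ))) ≤ s → 0 < s ^ 3 + (A : ℝ) * s + (B : ℝ) := by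
  have hW := Dup.wronskian_ne_zero (A : ℚ) (B : ℚ)
  have hI := Dup.isDatum (A : ℚ) (B : ℚ)
  refine ⟨Dup.isCoprime (A : ℚ) (B : ℚ) (by exact_mod_cast hΔ), hW, hI, ?_, ?_⟩
  · exact max_le (Dup.natDegree_f₂_le (A : ℚ) (B : ℚ))
      ((Dup.natDegree_g₂_le (A : ℚ) (B : ℚ)).trans (by norm_num))
  · rintro x ⟨hP, hg, hWx⟩ s hs
    refine Dup.cubic_pos_of_roots_le (A : ℝ) (B : ℝ) _ (P'_comp_R_pos hW hI hP hg hWx)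
      (fun e he => ?_) hs
    have h1 : aeval x (X ^ 4 - C (2 * (A : ℚ)) * X ^ 2 - C (8 * (B : ℚ)) * X + C ((A : ℚ) ^ 2)) =
        x ^ 4 - 2 * (A : ℝ) * x ^ 2 - 8 * (B : ℝ) * x + (A : ℝ) ^ 2 := by
      simp only [map_sub, map_add, map_mul, map_pow, aeval_X, aeval_C, eq_ratCast]
      push_cast
      ring
    have h2 : aeval x (C (4 : ℚ) * (X ^ 3 + C (A : ℚ) * X + C (B : ℚ))) =
        4 * (x ^ 3 + (A : ℝ) * x + (B : ℝ)) := by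
      simp only [map_add, map_mul, map_pow, aeval_X, aeval_C, eq_ratCast]
      push_cast
      ring
    rw [h1, h2]
    exact Dup.root_le_xMap (A : ℝ) (B : ℝ) e x he hP

end Summit.KontsevichZagierPeriods.IsogenyCertificates.EffectiveXMapChainsLine
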